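import Literature.MathematicalPhysics.QuantumFieldTheory.Balaban1983to89.B9Thm31SiteCoerciveReg335BlockY

/-!
# `Balaban1983to89.B9Thm31SiteCoerciveReg335Y` — T. Bałaban, *Propagators for lattice gauge theories in a background field*, Commun. Math. Phys.
# **99** (1985) 389–434 [Balaban1985BackgroundPropagators] Thm 3.1 p. 397 ∕ Thm 3.11 p. 416 with (3.24) p. 394, (3.35) p. 396 and [4] (2.14) p. 225:
# ★ **THE UNIFORM COERCIVITY OF def-Y's `Δ′_a(U)` ON THE (3.35) CLASS** — for `c·M·α₀ ≤ 1∕(16(d+1))` and every `U ∈ (bg9K (M_N ℂ) G i).Reg335 c α₀`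
# (`G ≤ U(N)`): `(1∕8)·Σ_z L^{−2·lev z}·HS(Φ z) ≤ Re⟨Φ, Δ′_a(U)Φ⟩`, hence `(1∕8)·L^{−2k}·⟨Φ, Φ⟩ ≤ Re⟨Φ, Δ′_a(U)Φ⟩` — constants free of the member, the
# volume, the number of levels and the background (file 3c, the assembly of the site-operator coercivity set)

statement-level skeleton of published theorems with citation tags; proofs where landed; nothing here is a claim about the Yang–Mills mass gap

THE PRINT (verbatim).  Thm 3.1 p. 397 is stated for backgrounds in the class (3.35) with `M` large and `α₀` small; p. 395: *«Assuming some regularity of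
the configuration U it can be easily shown that the operator Δ′_a is positive»*; Thm 3.11 p. 416: *«Under the assumptions of the Theorems 3.1–3.10 (i.e.
for M sufficiently large and α₀ sufficiently small) the operators Δ′_a, G′, (Q′G′²Q′\*)⁻¹, Δ_a, G are positive definite. … The proof can be reduced to a
proof of positivity of the operators G_□ … Doing the gauge transformation we get U = e^{iηA} with A small … In [4] we have proved that the operator G_□(1) is
positive»*; [4] p. 225: *«The operator G′ = Δ′_a^{−1} is a well defined, positive operator»*, with the block form (2.14).

WHY THIS FILE (cell `pub-ymgap`, Track A node N06 [B9], width seat `pub-ymgap-dag-n06-w1`, OFFER-A = W-SEAT-START-LIST §n06 item 1's successor «Thm 3.1 at the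
instance»).  dag-n06-j proved the QUALITATIVE statement at def-Y's v4 letters (`B9Thm311DeltaPrimePos.deltaPrimeAY_parSymY_posDefTr`: `Δ′_a(U) > 0` for every
unitary-valued `U`, no smallness).  THIS FILE proves the QUANTITATIVE statement print's Thm 3.1 ∕ 3.11 rest on, at the same letters and on def-Y's typed class
(3.35): a lower bound for (3.24)'s form that is UNIFORM in the background over the class, in the member (volume, `k`) and in `N`, by print's own mechanism
(p. 416): block by block (dag-n06-j's `trIP_deltaPrimeAY_eq`), in the (3.35) cube gauge of the block's big block (file 3a), the block's share of the form is
the flat block form of the gauged section up to `O((Mα₀)²)·L^{−2j}` (files 2, 2b, 3b), and the flat block form is `≥ min(2∕n², a_j∕n²)·(mass)` by the block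
Poincaré inequality and the block-average term (file 1); summing over `𝔅` with `a_j ∈ [1 − L^{−2}, 1]` gives the constant `1∕8` at `c·M·α₀ ≤ 1∕(16(d+1))`.
Consequence: the `L²`-operator norm of `G′(U) = Δ′_a(U)⁻¹` on the class is `≤ 8·L^{2k}` member-uniformly — the first uniform estimate on a genuine letter
of record at CURVED backgrounds in this cell (the row-17 clause `pos0` is its qualitative shadow; the bond-sector analogue is row 17's displayed `hΔA`).
PRIOR ART DECLARED: pub-balaban's NE9 chain (`B9Thm311SitePrimeFormCoercivePlaquette.exists_site_strong_coercive_of_small_plaquettes`) is the same theorem at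
ITS one-step letters (`TSite` carriers, axial gauges from plaquette smallness) — no bridge to def-Y's multi-level box-chart letters exists; nothing of it is
restated or imported.

WHAT IS PROVED (sorry-free; 0 `def`; no inequality of [B9] asserted as a hypothesis-free fact beyond what is proved).
* §1 bookkeeping: `aPrinted_ge_half` (`a_j ≥ 1∕2` for `L ≥ 5`), `levC_mul_side_pow` (`levC_j·n^{d+1} = a_j·n⁻²`), `coeff_ge` (the per-block coefficient of file 3b
  is `≥ (1∕8)·n⁻²` when `c·M·α₀ ≤ 1∕(16(d+1))`), `sum_sum_hs_cdS_ge_sum_rbond` (Σ_μΣ_z ≥ Σ over interior bonds grouped by block).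
* §2 ★★★ `trIP_deltaPrimeAY_parSymY_ge_levelMass` — `(1∕8)·Σ_z (L^{lev z})⁻²·HS(Φ z) ≤ trIP 1 Φ (Δ′_a(U)Φ)`;
  ★★★ `trIP_deltaPrimeAY_parSymY_ge` — `(1∕8)·(L^k)⁻²·trIP 1 Φ Φ ≤ trIP 1 Φ (Δ′_a(U)Φ)` (Thm 3.1's positivity constant at def-Y's letters, uniform).
MODEL ∕ DECLARED READINGS.  (M1) def-Y's letter `deltaPrimeAY i (parSymY i) U` on NODE 00's box chart, fibre `M_N(ℂ)`, HS ∕ trace currency `trIP 1` of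
dag-n06-j, `N ≥ 1`; (M2) the class is def-Y's `(bg9K (M_N ℂ) G i).Reg335 c α₀` over MODULE 2's cube class `cubeClass396` (the record's `bg9Y` is two such
indices); the threshold `c·M·α₀ ≤ 1∕(16(d+1))` is this file's witness for print's «α₀ sufficiently small» (no `M` largeness is needed for Δ′_a); (M3) the
mass is in LATTICE units of the member (`L^{−2j}` per level-`j` site, print's `a_j(Lʲη)⁻²·η²`).  NOT HERE: the decay of `G′(U)` (Thm 3.1's (3.42)–(3.47)),
the bond operator `Δ_a(U)` (row 17's `hΔA`), anything at `U ∉` the class.  NON-VACUITY (the cell's A6 rule): the class hypothesis is inhabited at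
every threshold — `U ≡ 1 ∈ Reg335 c α₀` for `c, α₀ > 0` (def-Y's `B9BackgroundsKLevelV1.reg335_one`), and by every pure gauge (dag-n06-j's
`B9Eq335PureGaugeInClassAtLettersY`); at `U ≡ 1` the bound is the flat [4] statement with an explicit constant.
HONEST SCOPE.  A theorem about one finite lattice operator at a time, constants explicit; NOT a node discharge, NOT summit progress; count-neutral; nothing
continuum ∕ OS ∕ mass gap ∕ Clay.
-/

noncomputable section

namespace Literature.MathematicalPhysics.QuantumFieldTheory.Balaban1983to89.B9Thm31SiteCoerciveReg335Y

open Literature.MathematicalPhysics.QuantumFieldTheory.Balaban1983to89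
open Node00 B6KLevelCensusIndexV1 B6Geom246MultiLevelBox B6MultiLevelBoxOperator B6MultiLevelTorusOperator B6GlobalChartV1 B9BackgroundsKLevelV1
  B9Eq39Adjoint B9Thm311ReadingCoords B9Thm311DeltaPrimePos B9Ineq369CurvatureSmallAtLettersY B9Thm31SiteCoerciveGaugeBlockY
  B9Thm31SiteCoerciveReg335BlockY
open Literature.MathematicalPhysics.QuantumFieldTheory.Balaban1983to89.B4Reflection242 (boxDom blk mem_boxDom)
open Literature.MathematicalPhysics.QuantumFieldTheory.Balaban1983to89.B4Lower18 (RBond rsrc rtgt)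
open scoped Matrix Matrix.Norms.L2Operator

variable {d ℓ : ℕ} {hd : 1 ≤ d + 1} {hL : Odd (ℓ + 1) ∧ 1 < ℓ + 1} {b₀ b₁ : ℝ}

/-! ## §1 Bookkeeping: the weights, the per-block coefficient, the gradient sum over interior bonds -/

section Bookkeeping

variable (i : KIdx d ℓ hd hL b₀ b₁)

/-- `a_j ≥ 1∕2` along the printed sequence (`a₁ = 1`, `a_j ≥ 1 − L^{−2}`, `L = ℓ + 1 ≥ 5`). [cite: Balaban1984PropagatorsII, (2.14) p.225; Balaban1982Higgs1, (2.15) p.609] -/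
theorem aPrinted_ge_half (s : BlkY i) : (1 / 2 : ℝ) ≤ aPrinted ℓ 1 s.1.1 := by
  have hℓ : 4 ≤ ℓ := i.hℓ
  have hℓ1 : 1 ≤ ℓ := by omega
  have hw := (aPrinted_window hℓ1 one_pos (one_le_level i s)).1
  have hL5 : (5 : ℝ) ≤ (ℓ : ℝ) + 1 := by
    have : (4 : ℝ) ≤ ℓ := by exact_mod_cast hℓ
    linarith
  have hinv : ((((ℓ : ℝ) + 1)) ^ 2)⁻¹ ≤ 1 / 2 := by
    rw [inv_le_comm₀ (by positivity) (by norm_num)]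
    nlinarith
  linarith

/-- the block mass: `levC_j · n^{d+1} = a_j · n⁻²`, `n = L^j`. [cite: Balaban1984PropagatorsII, (2.14) p.225, bookkeeping] -/
theorem levC_mul_side_pow (s : BlkY i) :
    levC d ℓ (aPrinted ℓ 1) s.1.1 * (((ℓ + 1) ^ s.1.1 : ℕ) : ℝ) ^ (d + 1) = aPrinted ℓ 1 s.1.1 * ((((ℓ + 1) ^ s.1.1 : ℕ) : ℝ) ^ 2)⁻¹ := by
  unfold levC
  have hn : (0 : ℝ) < (((ℓ + 1) ^ s.1.1 : ℕ) : ℝ) := by positivity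
  have e : ((((ℓ : ℝ) + 1)) ^ s.1.1) = (((ℓ + 1) ^ s.1.1 : ℕ) : ℝ) := by push_cast; ring
  rw [e]
  field_simp

/-- ★ THE PER-BLOCK COEFFICIENT IS AT LEAST `(1∕8)·n⁻²`: with `a ∈ [1∕2, 1]`, `n ≥ 2`, `0 ≤ ρ ≤ 2C∕n`, `0 ≤ C ≤ 1∕(16D)`, `1 ≤ D`,
`½·min(2∕((n−1)n), a∕n²) − 4Dρ² − 4(a∕n²)(D(n−1)ρ)² ≥ (1∕8)·n⁻²`. [folklore] -/
private theorem coeff_ge {a n ρ C D : ℝ} (ha1 : 1 / 2 ≤ a) (ha2 : a ≤ 1) (hn : 2 ≤ n) (hρ0 : 0 ≤ ρ) (hρ : ρ ≤ 2 * C * n⁻¹)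
    (hC0 : 0 ≤ C) (hCD : C * D ≤ 1 / 16) (hD : 1 ≤ D) :
    (1 / 8 : ℝ) * (n ^ 2)⁻¹
      ≤ (1 / 2 : ℝ) * min (1 / ((n - 1) * n / 2)) (a * (n ^ 2)⁻¹) - 4 * D * ρ ^ 2 - 4 * (a * (n ^ 2)⁻¹) * (D * ((n - 1) * ρ)) ^ 2 := by
  have hn0 : 0 < n := by linarith
  have hn2 : 0 < n ^ 2 := by positivity
  have hinv : 0 < (n ^ 2)⁻¹ := inv_pos.2 hn2
  -- the minimum is the averaging mass
  have hmin : a * (n ^ 2)⁻¹ ≤ min (1 / ((n - 1) * n / 2)) (a * (n ^ 2)⁻¹) := by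
    refine le_min ?_ le_rfl
    rw [div_div_eq_mul_div, one_mul, le_div_iff₀ (by nlinarith)]
    calc a * (n ^ 2)⁻¹ * ((n - 1) * n) ≤ 1 * (n ^ 2)⁻¹ * (n * n) := by
          apply mul_le_mul (mul_le_mul_of_nonneg_right ha2 hinv.le) (by nlinarith) (by nlinarith) (by positivity)
      _ = 1 := by field_simp
      _ ≤ 2 := by norm_num
  -- `ρ n ≤ 2C`, `(n−1)ρ ≤ 2C`
  have hρn : ρ * n ≤ 2 * C := by
    have := mul_le_mul_of_nonneg_right hρ hn0.le
    rwa [mul_assoc, inv_mul_cancel₀ hn0.ne', mul_one] at this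
  have hρn1 : (n - 1) * ρ ≤ 2 * C := by nlinarith
  have hρn1' : 0 ≤ (n - 1) * ρ := by nlinarith
  -- `ρ² ≤ 4C²∕n²`
  have hρ2 : ρ ^ 2 ≤ 4 * C ^ 2 * (n ^ 2)⁻¹ := by
    rw [show 4 * C ^ 2 * (n ^ 2)⁻¹ = (2 * C * n⁻¹) ^ 2 by field_simp; ring]
    exact pow_le_pow_left₀ hρ0 hρ 2
  have hD0 : 0 ≤ D := by linarith
  have hsq : (D * ((n - 1) * ρ)) ^ 2 ≤ (2 * C * D) ^ 2 := by
    have h1 : D * ((n - 1) * ρ) ≤ 2 * C * D := by nlinarith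
    exact pow_le_pow_left₀ (by positivity) h1 2
  have hCD0 : 0 ≤ C * D := by positivity
  have hCD2 : (2 * C * D) ^ 2 ≤ 1 / 64 := by
    have h := pow_le_pow_left₀ hCD0 hCD 2
    nlinarith
  -- the three pieces against `t = n⁻²`
  have h1 : (1 / 4 : ℝ) * (n ^ 2)⁻¹ ≤ (1 / 2 : ℝ) * min (1 / ((n - 1) * n / 2)) (a * (n ^ 2)⁻¹) := by nlinarith
  have h2 : 4 * D * ρ ^ 2 ≤ (1 / 16 : ℝ) * (n ^ 2)⁻¹ := by
    have hDC2 : D * C ^ 2 ≤ C * (1 / 16) := by nlinarith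
    have hC16 : C ≤ 1 / 16 := by nlinarith
    have : 4 * D * ρ ^ 2 ≤ 4 * D * (4 * C ^ 2 * (n ^ 2)⁻¹) := mul_le_mul_of_nonneg_left hρ2 (by positivity)
    nlinarith
  have h3 : 4 * (a * (n ^ 2)⁻¹) * (D * ((n - 1) * ρ)) ^ 2 ≤ (1 / 16 : ℝ) * (n ^ 2)⁻¹ := by
    have : 4 * (a * (n ^ 2)⁻¹) * (D * ((n - 1) * ρ)) ^ 2 ≤ 4 * (a * (n ^ 2)⁻¹) * (1 / 64) :=
      mul_le_mul_of_nonneg_left (hsq.trans hCD2) (by positivity)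
    nlinarith
  linarith

variable {N : ℕ}

/-- the gradient terms over ALL bonds dominate the gradient terms over the INTERIOR bonds of the blocks of `𝔅`, grouped by block.
[cite: Balaban1984PropagatorsII, (2.14) p.225 (one block of the form), bookkeeping] -/
theorem sum_sum_hs_cdS_ge_sum_rbond (U : CfgY (Matrix (Fin N) (Fin N) ℂ) i) (Φ : SiteY i → Matrix (Fin N) (Fin N) ℂ) :
    ∑ s : BlkY i, ∑ k ∈ Finset.univ.filter (fun k : RBond (toKT i).XB => blkOf i.D.toDomains (rsrc k) = s ∧ blkOf i.D.toDomains (rtgt k) = s),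
        ∑ a, ∑ b, ‖cdS i U k.1.2 Φ (rsrc k) a b‖ ^ 2
      ≤ ∑ μ : Fin (d + 1), ∑ z : SiteY i, ∑ a, ∑ b, ‖cdS i U μ Φ z a b‖ ^ 2 := by
  -- group the interior bonds by the block of their source
  have hfib : ∑ s : BlkY i, ∑ k ∈ Finset.univ.filter (fun k : RBond (toKT i).XB =>
        blkOf i.D.toDomains (rsrc k) = s ∧ blkOf i.D.toDomains (rtgt k) = s), ∑ a, ∑ b, ‖cdS i U k.1.2 Φ (rsrc k) a b‖ ^ 2
      = ∑ k ∈ Finset.univ.filter (fun k : RBond (toKT i).XB => blkOf i.D.toDomains (rsrc k) = blkOf i.D.toDomains (rtgt k)),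
          ∑ a, ∑ b, ‖cdS i U k.1.2 Φ (rsrc k) a b‖ ^ 2 := by
    rw [← Finset.sum_fiberwise (Finset.univ.filter (fun k : RBond (toKT i).XB => blkOf i.D.toDomains (rsrc k) = blkOf i.D.toDomains (rtgt k)))
      (fun k => blkOf i.D.toDomains (rsrc k)) (fun k => ∑ a, ∑ b, ‖cdS i U k.1.2 Φ (rsrc k) a b‖ ^ 2)]
    refine Finset.sum_congr rfl fun s _ => ?_
    rw [Finset.filter_filter]
    refine Finset.sum_congr (Finset.filter_congr fun k _ => ?_) fun _ _ => rfl
    constructor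
    · rintro ⟨h1, h2⟩; exact ⟨h1.trans h2.symm, h1⟩
    · rintro ⟨h1, h2⟩; exact ⟨h2, h1.symm.trans h2⟩
  rw [hfib]
  -- drop the condition, then inject `k ↦ (direction, source)`
  calc ∑ k ∈ Finset.univ.filter (fun k : RBond (toKT i).XB => blkOf i.D.toDomains (rsrc k) = blkOf i.D.toDomains (rtgt k)),
          ∑ a, ∑ b, ‖cdS i U k.1.2 Φ (rsrc k) a b‖ ^ 2
      ≤ ∑ k : RBond (toKT i).XB, ∑ a, ∑ b, ‖cdS i U k.1.2 Φ (rsrc k) a b‖ ^ 2 :=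
        Finset.sum_le_sum_of_subset_of_nonneg (Finset.filter_subset _ _) fun k _ _ => hs_nonneg _
    _ = ∑ p ∈ (Finset.univ : Finset (RBond (toKT i).XB)).image (fun k => (k.1.2, rsrc k)),
          ∑ a, ∑ b, ‖cdS i U p.1 Φ p.2 a b‖ ^ 2 := by
        rw [Finset.sum_image]
        intro k _ k' _ h
        simp only [Prod.mk.injEq] at h
        exact Subtype.ext (Prod.ext h.2 h.1)
    _ ≤ ∑ p ∈ (Finset.univ : Finset (Fin (d + 1) × SiteY i)), ∑ a, ∑ b, ‖cdS i U p.1 Φ p.2 a b‖ ^ 2 :=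
        Finset.sum_le_sum_of_subset_of_nonneg (Finset.subset_univ _) fun p _ _ => hs_nonneg _
    _ = ∑ μ : Fin (d + 1), ∑ z : SiteY i, ∑ a, ∑ b, ‖cdS i U μ Φ z a b‖ ^ 2 := by
        rw [← Finset.univ_product_univ, Finset.sum_product]

end Bookkeeping

/-! ## §2 The uniform coercivity of `Δ′_a(U)` on the class -/

section Main

variable (i : KIdx d ℓ hd hL b₀ b₁) {N : ℕ} {G : Subgroup (Matrix (Fin N) (Fin N) ℂ)ˣ}

/-- ★★★ **[B9] THM 3.1's POSITIVITY STEP AT def-Y's LETTERS, UNIFORM ON THE CLASS (3.35)**: for `G ≤ U(N)`, `N ≥ 1`, `0 ≤ c·M·α₀ ≤ 1∕(16(d+1))` and every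
`U ∈ (bg9K (M_N ℂ) G i).Reg335 c α₀`:  `(1∕8)·Σ_z (L^{lev z})⁻²·HS(Φ z) ≤ Re⟨Φ, Δ′_a(U)Φ⟩_tr` for every `Φ` — the level-weighted mass of (3.24) survives the
curved background with a constant free of the member, the volume, `k`, `N` and `U`. [cite: Balaban1985BackgroundPropagators, Thm 3.1 p.397, Thm 3.11 p.416, (3.24) p.394, (3.35) p.396; Balaban1984PropagatorsII, (2.14) p.225] -/
theorem trIP_deltaPrimeAY_parSymY_ge_levelMass [Nonempty (Fin N)] (hG : G ≤ B7Prop2Explicit.unitaryUnits (Matrix (Fin N) (Fin N) ℂ))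
    {U : CfgY (Matrix (Fin N) (Fin N) ℂ) i} {c α₀ : ℝ} (hC0 : 0 ≤ c * (kGeo i).M * α₀) (hC1 : c * (kGeo i).M * α₀ * ((d : ℝ) + 1) ≤ 1 / 16)
    (hreg : (bg9K (Matrix (Fin N) (Fin N) ℂ) G i).Reg335 c α₀ U) (Φ : SiteY i → Matrix (Fin N) (Fin N) ℂ) :
    (1 / 8 : ℝ) * ∑ z : SiteY i, (((((ℓ + 1) ^ (blkOf i.D.toDomains z).1.1 : ℕ) : ℝ)) ^ 2)⁻¹ * ∑ a, ∑ b, ‖Φ z a b‖ ^ 2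
      ≤ trIP (fun _ => (1 : ℝ)) Φ (deltaPrimeAY i (parSymY i) U Φ) := by
  have hU : ∀ μ x, U μ x ∈ G := hreg.1
  rw [trIP_deltaPrimeAY_eq i hG (parSymY i) U (parSymY_inv_symm U) (fun z w => parSymY_mem i hU z w) hU Φ]
  -- gradient part ≥ the interior-bond gradient terms grouped by block; rewrite the block sums in HS currency
  have hgrad : ∑ s : BlkY i, ∑ k ∈ Finset.univ.filter (fun k : RBond (toKT i).XB =>
        blkOf i.D.toDomains (rsrc k) = s ∧ blkOf i.D.toDomains (rtgt k) = s), ∑ a, ∑ b, ‖cdS i U k.1.2 Φ (rsrc k) a b‖ ^ 2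
      ≤ ∑ μ : Fin (d + 1), trIP (fun _ => (1 : ℝ)) (cdS i U μ Φ) (cdS i U μ Φ) := by
    have h := sum_sum_hs_cdS_ge_sum_rbond i U Φ
    refine h.trans (le_of_eq (Finset.sum_congr rfl fun μ _ => (trIP_one_self_eq _).symm))
  have hblk : ∀ s : BlkY i, levC d ℓ (aPrinted ℓ 1) s.1.1 * (Matrix.trace ((blkSumY i (parSymY i) U Φ s)ᴴ * blkSumY i (parSymY i) U Φ s)).re
      = levC d ℓ (aPrinted ℓ 1) s.1.1 * ∑ a, ∑ b, ‖blkSumY i (parSymY i) U Φ s a b‖ ^ 2 := fun s => by rw [hs_eq_re_trace]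
  rw [Finset.sum_congr rfl fun s _ => hblk s]
  -- per block
  have hper : ∀ s : BlkY i,
      (1 / 8 : ℝ) * (((((ℓ + 1) ^ s.1.1 : ℕ) : ℝ)) ^ 2)⁻¹ * ∑ z ∈ Finset.univ.filter (fun z : SiteY i => blkOf i.D.toDomains z = s), ∑ a, ∑ b, ‖Φ z a b‖ ^ 2
        ≤ ∑ k ∈ Finset.univ.filter (fun k : RBond (toKT i).XB => blkOf i.D.toDomains (rsrc k) = s ∧ blkOf i.D.toDomains (rtgt k) = s),
              ∑ a, ∑ b, ‖cdS i U k.1.2 Φ (rsrc k) a b‖ ^ 2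
          + levC d ℓ (aPrinted ℓ 1) s.1.1 * ∑ a, ∑ b, ‖blkSumY i (parSymY i) U Φ s a b‖ ^ 2 := by
    intro s
    have hκ : 0 ≤ levC d ℓ (aPrinted ℓ 1) s.1.1 := (levC_blk_pos i s).le
    have hb := block_form_ge_reg335 i hG hC0 hreg hκ s Φ
    refine le_trans ?_ hb
    have hm0 : 0 ≤ ∑ z ∈ Finset.univ.filter (fun z : SiteY i => blkOf i.D.toDomains z = s), ∑ a, ∑ b, ‖Φ z a b‖ ^ 2 :=
      Finset.sum_nonneg fun _ _ => hs_nonneg _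
    refine mul_le_mul_of_nonneg_right ?_ hm0
    -- the coefficient
    have hn2 : (2 : ℝ) ≤ (((ℓ + 1) ^ s.1.1 : ℕ) : ℝ) := by exact_mod_cast two_le_side i s
    have hn1 : (1 : ℕ) ≤ (ℓ + 1) ^ s.1.1 := Nat.one_le_pow _ _ (Nat.succ_pos ℓ)
    have hsub : ((((ℓ + 1) ^ s.1.1 - 1 : ℕ) : ℝ)) = (((ℓ + 1) ^ s.1.1 : ℕ) : ℝ) - 1 := by
      rw [Nat.cast_sub hn1]; push_cast; ring
    have hκn : levC d ℓ (aPrinted ℓ 1) s.1.1 * (((ℓ + 1) ^ s.1.1 : ℕ) : ℝ) ^ (d + 1) = aPrinted ℓ 1 s.1.1 * ((((ℓ + 1) ^ s.1.1 : ℕ) : ℝ) ^ 2)⁻¹ :=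
      levC_mul_side_pow i s
    have hρ0 : 0 ≤ Real.exp ((c * (kGeo i).M * α₀) * ((((ℓ + 1 : ℕ) : ℝ) ^ s.1.1)⁻¹)) - 1 := by
      rw [sub_nonneg]; exact Real.one_le_exp (mul_nonneg hC0 (inv_nonneg.2 (by positivity)))
    have hn' : (((ℓ + 1 : ℕ) : ℝ) ^ s.1.1) = (((ℓ + 1) ^ s.1.1 : ℕ) : ℝ) := by push_cast; ring
    have hρ : Real.exp ((c * (kGeo i).M * α₀) * ((((ℓ + 1 : ℕ) : ℝ) ^ s.1.1)⁻¹)) - 1 ≤ 2 * (c * (kGeo i).M * α₀) * ((((ℓ + 1) ^ s.1.1 : ℕ) : ℝ))⁻¹ := by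
      rw [hn']
      have hx0 : 0 ≤ (c * (kGeo i).M * α₀) * ((((ℓ + 1) ^ s.1.1 : ℕ) : ℝ))⁻¹ := mul_nonneg hC0 (inv_nonneg.2 (by positivity))
      have hx1 : (c * (kGeo i).M * α₀) * ((((ℓ + 1) ^ s.1.1 : ℕ) : ℝ))⁻¹ ≤ 1 := by
        have hd1 : (1 : ℝ) ≤ (d : ℝ) + 1 := by have : (0 : ℝ) ≤ d := Nat.cast_nonneg d; linarith
        have hC1' : c * (kGeo i).M * α₀ ≤ 1 := by nlinarith
        have hinv1 : ((((ℓ + 1) ^ s.1.1 : ℕ) : ℝ))⁻¹ ≤ 1 := inv_le_one_of_one_le₀ (by linarith)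
        nlinarith [inv_nonneg.2 (show (0:ℝ) ≤ (((ℓ + 1) ^ s.1.1 : ℕ) : ℝ) by positivity)]
      have h := Real.abs_exp_sub_one_le (x := (c * (kGeo i).M * α₀) * ((((ℓ + 1) ^ s.1.1 : ℕ) : ℝ))⁻¹) (by rw [abs_of_nonneg hx0]; exact hx1)
      rw [abs_of_nonneg hx0] at h
      have h' := le_of_abs_le h
      linarith
    have key := coeff_ge (a := aPrinted ℓ 1 s.1.1) (n := (((ℓ + 1) ^ s.1.1 : ℕ) : ℝ))
      (ρ := Real.exp ((c * (kGeo i).M * α₀) * ((((ℓ + 1 : ℕ) : ℝ) ^ s.1.1)⁻¹)) - 1) (C := c * (kGeo i).M * α₀) (D := (d : ℝ) + 1)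
      (aPrinted_ge_half i s) (B6Prop23KLevelTorusCensus.aPrinted_le_one (by have := i.hℓ; omega) _ (one_le_level i s)) hn2 hρ0 hρ hC0 hC1
      (by have : (0 : ℝ) ≤ d := Nat.cast_nonneg d; linarith)
    have e4 : 4 * levC d ℓ (aPrinted ℓ 1) s.1.1 * (((ℓ + 1) ^ s.1.1 : ℕ) : ℝ) ^ (d + 1) *
          ((((d + 1 : ℕ) : ℝ)) * (((((ℓ + 1) ^ s.1.1 - 1 : ℕ) : ℝ)) * (Real.exp ((c * (kGeo i).M * α₀) * ((((ℓ + 1 : ℕ) : ℝ) ^ s.1.1)⁻¹)) - 1))) ^ 2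
        = 4 * (levC d ℓ (aPrinted ℓ 1) s.1.1 * (((ℓ + 1) ^ s.1.1 : ℕ) : ℝ) ^ (d + 1)) *
          (((d : ℝ) + 1) * (((((ℓ + 1) ^ s.1.1 : ℕ) : ℝ) - 1) * (Real.exp ((c * (kGeo i).M * α₀) * ((((ℓ + 1 : ℕ) : ℝ) ^ s.1.1)⁻¹)) - 1))) ^ 2 := by
      rw [hsub]; push_cast; ring
    rw [e4, hκn]
    exact key
  -- sum over the blocks and regroup the mass by sites
  have hsum := Finset.sum_le_sum fun s (_ : s ∈ Finset.univ) => hper s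
  rw [Finset.sum_add_distrib] at hsum
  have hmass : ∑ s : BlkY i, (1 / 8 : ℝ) * (((((ℓ + 1) ^ s.1.1 : ℕ) : ℝ)) ^ 2)⁻¹ *
        ∑ z ∈ Finset.univ.filter (fun z : SiteY i => blkOf i.D.toDomains z = s), ∑ a, ∑ b, ‖Φ z a b‖ ^ 2
      = (1 / 8 : ℝ) * ∑ z : SiteY i, (((((ℓ + 1) ^ (blkOf i.D.toDomains z).1.1 : ℕ) : ℝ)) ^ 2)⁻¹ * ∑ a, ∑ b, ‖Φ z a b‖ ^ 2 := by
    rw [Finset.mul_sum, ← Finset.sum_fiberwise Finset.univ (fun z : SiteY i => blkOf i.D.toDomains z)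
      (fun z => (1 / 8 : ℝ) * ((((((ℓ + 1) ^ (blkOf i.D.toDomains z).1.1 : ℕ) : ℝ)) ^ 2)⁻¹ * ∑ a, ∑ b, ‖Φ z a b‖ ^ 2))]
    refine Finset.sum_congr rfl fun s _ => ?_
    rw [Finset.mul_sum]
    refine Finset.sum_congr rfl fun z hz => ?_
    rw [(Finset.mem_filter.1 hz).2]
    ring
  rw [← hmass]
  exact hsum.trans (add_le_add hgrad le_rfl)

/-- ★★★ **THE UNIFORM `L^{−2k}` LOWER BOUND** (every level `j ≤ k`): on the class, `(1∕8)·(L^k)⁻²·⟨Φ, Φ⟩ ≤ Re⟨Φ, Δ′_a(U)Φ⟩` — so `G′(U) = Δ′_a(U)⁻¹` (dag-n06-j's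
`isUnit_deltaPrimeAY_parSymY`) has `L²`-operator norm `≤ 8·L^{2k}` UNIFORMLY over the class, the member and `N`.
[cite: Balaban1985BackgroundPropagators, Thm 3.1 p.397, Thm 3.11 p.416; Balaban1984PropagatorsII, p.225 («G′ = Δ′_a^{−1} is a well defined, positive operator»)] -/
theorem trIP_deltaPrimeAY_parSymY_ge [Nonempty (Fin N)] (hG : G ≤ B7Prop2Explicit.unitaryUnits (Matrix (Fin N) (Fin N) ℂ))
    {U : CfgY (Matrix (Fin N) (Fin N) ℂ) i} {c α₀ : ℝ} (hC0 : 0 ≤ c * (kGeo i).M * α₀) (hC1 : c * (kGeo i).M * α₀ * ((d : ℝ) + 1) ≤ 1 / 16)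
    (hreg : (bg9K (Matrix (Fin N) (Fin N) ℂ) G i).Reg335 c α₀ U) (Φ : SiteY i → Matrix (Fin N) (Fin N) ℂ) :
    (1 / 8 : ℝ) * (((((ℓ + 1) ^ i.k : ℕ) : ℝ)) ^ 2)⁻¹ * trIP (fun _ => (1 : ℝ)) Φ Φ ≤ trIP (fun _ => (1 : ℝ)) Φ (deltaPrimeAY i (parSymY i) U Φ) := by
  refine le_trans ?_ (trIP_deltaPrimeAY_parSymY_ge_levelMass i hG hC0 hC1 hreg Φ)
  rw [trIP_one_self_eq, Finset.mul_sum, Finset.mul_sum]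
  refine Finset.sum_le_sum fun z _ => ?_
  have hz0 : 0 ≤ ∑ a, ∑ b, ‖Φ z a b‖ ^ 2 := hs_nonneg _
  have hjk : (blkOf i.D.toDomains z).1.1 ≤ i.k := (scale_bounds i.D.toDomains _).2
  have hpow : (((ℓ + 1) ^ (blkOf i.D.toDomains z).1.1 : ℕ) : ℝ) ≤ (((ℓ + 1) ^ i.k : ℕ) : ℝ) := by
    exact_mod_cast Nat.pow_le_pow_right (Nat.succ_pos ℓ) hjk
  have hpos : (0 : ℝ) < (((ℓ + 1) ^ (blkOf i.D.toDomains z).1.1 : ℕ) : ℝ) := by positivity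
  have hinv : (((((ℓ + 1) ^ i.k : ℕ) : ℝ)) ^ 2)⁻¹ ≤ (((((ℓ + 1) ^ (blkOf i.D.toDomains z).1.1 : ℕ) : ℝ)) ^ 2)⁻¹ := by
    apply inv_anti₀ (by positivity)
    exact pow_le_pow_left₀ hpos.le hpow 2
  rw [mul_assoc]
  exact mul_le_mul_of_nonneg_left (mul_le_mul_of_nonneg_right hinv hz0) (by norm_num)

end Main

end Literature.MathematicalPhysics.QuantumFieldTheory.Balaban1983to89.B9Thm31SiteCoerciveReg335Y
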